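import Mathlib.Analysis.SpecialFunctions.SmoothTransition
import Mathlib.Analysis.SpecialFunctions.Complex.Log
import Mathlib.Analysis.SpecialFunctions.ExpDeriv
import Mathlib.Analysis.InnerProductSpace.PiL2
import Mathlib.Analysis.Calculus.InverseFunctionTheorem.FDeriv
import Mathlib.Analysis.Normed.Module.FiniteDimension
import Mathlib.Topology.Compactness.Compact
import HarnessLib

/-!
# Elementary analysis for explicit bands: cut-offs, clamps, a rotating planar field, local
# injectivity of immersions

Topic `Literature/Topology/FourManifolds` (trunk T-4MAN); fact seat
`provefact-Literature.Topology.FourManifolds.Knot.exists_isBandSum` (`BandSum.lean`: existence of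
band sums, Gompf–Stipsicz (1999), §5.1).  The band between two knots is written by one explicit
formula in the tubular coordinates of an auxiliary embedded circle; this file collects the
elementary real-analysis ingredients of that formula and of its verification:

* `Literature.Topology.FourManifolds.exists_smooth_clamp` — a `C^∞` function `ℝ → ℝ` which is the
  identity on `[-a, a]` and bounded by `2a` (to globalise germs of coordinate functions);
* `Literature.Topology.FourManifolds.exists_rotating_field` — a `C^∞` nowhere-vanishing planar
  field `v : ℝ → ℝ²` equal to a given `d₁ ≠ 0` for `x ≤ 1/4` and to a given `d₂ ≠ 0` for `x ≥ 3/4`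
  (rotation through the complex logarithm `z₁ exp (λ log (z₂/z₁))`);
* `Literature.Topology.FourManifolds.exists_mem_nhds_injOn_of_hasStrictFDerivAt` — **an
  immersion is locally injective**: a map with a strict derivative which is an injective linear
  map on a finite-dimensional source is injective near the point (the derivative is
  anti-Lipschitz, `LinearMap.injective_iff_antilipschitz`, and the map approximates it,
  `HasStrictFDerivAt.approximates_deriv_on_nhds`);
* `Literature.Topology.FourManifolds.injective_of_linearIndependent_pair`,
  `Literature.Topology.FourManifolds.isOpen_setOf_injective_fderiv_two`,
  `Literature.Topology.FourManifolds.exists_forall_injective_fderiv_near` — injectivity of the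
  differential of a `C¹` map of two real variables is an open condition, hence holds uniformly
  near a compact segment on which it holds.

Everything here is proved; no definitions, no named facts.

## References

* M. W. Hirsch, *Differential Topology*, GTM 33 (1976), Ch. 1 §3 and Ch. 2 §1 (immersions are
  locally embeddings). [Hirsch1976]
-/

open scoped Topology ContDiff
open Function Set Filter Metric

noncomputable section

namespace Literature.Topology.FourManifolds

/-! ### A smooth clamp -/

/-- **A smooth clamp**: for `a > 0` a `C^∞` function `cl : ℝ → ℝ` with `cl y = y` for `|y| ≤ a`
and `|cl y| ≤ 2a` everywhere (`y` times the product of two smooth transitions). [folklore] -/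
theorem exists_smooth_clamp {a : ℝ} (ha : 0 < a) :
    ∃ cl : ℝ → ℝ, ContDiff ℝ ∞ cl ∧ (∀ y, |y| ≤ a → cl y = y) ∧ ∀ y, |cl y| ≤ 2 * a := by
  set χ : ℝ → ℝ := fun y ↦ Real.smoothTransition (2 - y / a) * Real.smoothTransition (2 + y / a)
    with hχ
  have hχs : ContDiff ℝ ∞ χ :=
    (Real.smoothTransition.contDiff.comp (contDiff_const.sub (contDiff_id.div_const a))).mul
      (Real.smoothTransition.contDiff.comp (contDiff_const.add (contDiff_id.div_const a)))
  have hχ01 : ∀ y, 0 ≤ χ y ∧ χ y ≤ 1 := fun y ↦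
    ⟨mul_nonneg (Real.smoothTransition.nonneg _) (Real.smoothTransition.nonneg _),
      mul_le_one₀ (Real.smoothTransition.le_one _) (Real.smoothTransition.nonneg _)
        (Real.smoothTransition.le_one _)⟩
  refine ⟨fun y ↦ y * χ y, contDiff_id.mul hχs, fun y hy ↦ ?_, fun y ↦ ?_⟩
  · have hya : |y / a| ≤ 1 := by
      rw [abs_div, abs_of_pos ha, div_le_one ha]
      exact hy
    have h1 : Real.smoothTransition (2 - y / a) = 1 :=
      Real.smoothTransition.one_of_one_le (by linarith [(abs_le.1 hya).2])
    have h2 : Real.smoothTransition (2 + y / a) = 1 :=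
      Real.smoothTransition.one_of_one_le (by linarith [(abs_le.1 hya).1])
    change y * χ y = y
    rw [hχ]
    dsimp only
    rw [h1, h2, mul_one, mul_one]
  · change |y * χ y| ≤ 2 * a
    by_cases hy : |y| ≤ 2 * a
    · rw [abs_mul, abs_of_nonneg (hχ01 y).1]
      calc |y| * χ y ≤ 2 * a * 1 := mul_le_mul hy (hχ01 y).2 (hχ01 y).1 (by positivity)
        _ = 2 * a := mul_one _
    · rw [not_le] at hy
      have h0 : χ y = 0 := by
        rcases le_or_gt 0 y with hy0 | hy0
        · rw [abs_of_nonneg hy0] at hy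
          have : Real.smoothTransition (2 - y / a) = 0 :=
            Real.smoothTransition.zero_of_nonpos (by
              rw [sub_nonpos, le_div_iff₀ ha]; linarith)
          simp [hχ, this]
        · rw [abs_of_neg hy0] at hy
          have : Real.smoothTransition (2 + y / a) = 0 :=
            Real.smoothTransition.zero_of_nonpos (by
              have : y / a < -2 := by rw [div_lt_iff₀ ha]; linarith
              linarith)
          simp [hχ, this]
      rw [h0, mul_zero, abs_zero]
      positivity

/-! ### A rotating nowhere-vanishing planar field -/

/-- **Rotating a nonzero planar vector into another without passing through zero**: for
`d₁, d₂ ≠ 0` in `ℝ²` there is a `C^∞` field `v : ℝ → ℝ²`, nowhere zero, with `v x = d₁` for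
`x ≤ 1/4` and `v x = d₂` for `x ≥ 3/4` (in `ℂ ≅ ℝ²`: `z₁ exp (λ(x) log (z₂/z₁))` with a smooth
transition `λ`). [folklore] -/
theorem exists_rotating_field {d₁ d₂ : EuclideanSpace ℝ (Fin 2)} (h₁ : d₁ ≠ 0) (h₂ : d₂ ≠ 0) :
    ∃ v : ℝ → EuclideanSpace ℝ (Fin 2), ContDiff ℝ ∞ v ∧ (∀ x, x ≤ 1 / 4 → v x = d₁) ∧
      (∀ x, 3 / 4 ≤ x → v x = d₂) ∧ ∀ x, v x ≠ 0 := by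
  set Rp : ℂ ≃ₗᵢ[ℝ] EuclideanSpace ℝ (Fin 2) := Complex.orthonormalBasisOneI.repr with hRp
  set z₁ : ℂ := Rp.symm d₁ with hz₁
  set z₂ : ℂ := Rp.symm d₂ with hz₂
  have hz₁0 : z₁ ≠ 0 := fun h ↦ h₁ (by simpa [hz₁] using congrArg Rp h)
  have hz₂0 : z₂ ≠ 0 := fun h ↦ h₂ (by simpa [hz₂] using congrArg Rp h)
  set Lg : ℂ := Complex.log (z₂ / z₁) with hLg
  set lam : ℝ → ℝ := fun x ↦ Real.smoothTransition (2 * x - 1 / 2) with hlam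
  have hlams : ContDiff ℝ ∞ lam :=
    Real.smoothTransition.contDiff.comp ((contDiff_const.mul contDiff_id).sub contDiff_const)
  set V : ℝ → ℂ := fun x ↦ z₁ * Complex.exp ((lam x : ℂ) * Lg) with hV
  have hVs : ContDiff ℝ ∞ V := by
    have h1 : ContDiff ℝ ∞ fun x : ℝ ↦ ((lam x : ℂ) * Lg) :=
      (Complex.ofRealCLM.contDiff.comp hlams).mul contDiff_const
    exact contDiff_const.mul ((Complex.contDiff_exp (𝕜 := ℝ)).comp h1)
  have hVne : ∀ x, V x ≠ 0 := fun x ↦ mul_ne_zero hz₁0 (Complex.exp_ne_zero _)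
  refine ⟨fun x ↦ Rp (V x), Rp.toContinuousLinearEquiv.contDiff.comp hVs, fun x hx ↦ ?_,
    fun x hx ↦ ?_, fun x hx0 ↦ ?_⟩
  · have hl : lam x = 0 := Real.smoothTransition.zero_of_nonpos (by linarith)
    change Rp (z₁ * Complex.exp ((lam x : ℂ) * Lg)) = d₁
    rw [hl, Complex.ofReal_zero, zero_mul, Complex.exp_zero, mul_one, hz₁, Rp.apply_symm_apply]
  · have hl : lam x = 1 := Real.smoothTransition.one_of_one_le (by linarith)
    change Rp (z₁ * Complex.exp ((lam x : ℂ) * Lg)) = d₂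
    rw [hl, Complex.ofReal_one, one_mul, hLg, Complex.exp_log (div_ne_zero hz₂0 hz₁0),
      mul_div_cancel₀ _ hz₁0, hz₂, Rp.apply_symm_apply]
  · refine hVne x (Rp.injective ?_)
    have hx0' : Rp (V x) = 0 := hx0
    rw [hx0', map_zero]

/-! ### Local injectivity of immersions -/

/-- **A map with injective strict derivative is injective near the point** (finite-dimensional
source): the derivative `f'` is anti-Lipschitz with some constant `K`
(`LinearMap.injective_iff_antilipschitz`), `f` approximates `f'` to within `K⁻¹/2` on a
neighbourhood (`HasStrictFDerivAt.approximates_deriv_on_nhds`), so `f` is anti-Lipschitz there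
(`AntilipschitzWith.add_lipschitzWith`).  Hirsch (1976), Ch. 2 §1 (an immersion is locally an
embedding). [cite: Hirsch1976, Ch. 2 §1] -/
theorem exists_mem_nhds_injOn_of_hasStrictFDerivAt {E' F' : Type*} [NormedAddCommGroup E']
    [NormedSpace ℝ E'] [FiniteDimensional ℝ E'] [NormedAddCommGroup F'] [NormedSpace ℝ F']
    {f : E' → F'} {f' : E' →L[ℝ] F'} {a : E'} (hf : HasStrictFDerivAt f f' a)
    (hinj : Injective f') : ∃ s ∈ 𝓝 a, InjOn f s := by
  obtain ⟨K, hK0, hK⟩ := (LinearMap.injective_iff_antilipschitz (f' : E' →ₗ[ℝ] F')).1 hinj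
  have hK' : AntilipschitzWith K f' := hK
  have hc : (0 : NNReal) < K⁻¹ / 2 := by
    have : (0 : NNReal) < K⁻¹ := inv_pos.2 hK0
    exact div_pos this two_pos
  obtain ⟨s, hs, happ⟩ := hf.approximates_deriv_on_nhds (c := K⁻¹ / 2) (Or.inr hc)
  refine ⟨s, hs, ?_⟩
  have h1 : AntilipschitzWith K (s.restrict ⇑f') := hK'.restrict s
  have h2 : LipschitzWith (K⁻¹ / 2) (fun x : s ↦ f x - f' x) := happ.lipschitz_sub
  have hlt : K⁻¹ / 2 < K⁻¹ := NNReal.half_lt_self (inv_pos.2 hK0).ne'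
  have h3 := h1.add_lipschitzWith h2 hlt
  have heq : (fun x : s ↦ (s.restrict ⇑f') x + (f x - f' x)) = s.restrict f := by
    funext x
    simp [restrict]
  rw [heq] at h3
  exact injOn_iff_injective.2 h3.injective

/-! ### Injectivity of the differential of a map of two variables is open -/

/-- A linear map of `ℝ × ℝ` whose values on `(1, 0)`, `(0, 1)` are linearly independent is
injective. [folklore] -/
theorem injective_of_linearIndependent_pair {F' : Type*} [AddCommGroup F'] [Module ℝ F']
    {A : ℝ × ℝ →ₗ[ℝ] F'} (h : LinearIndependent ℝ ![A (1, 0), A (0, 1)]) : Injective A := by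
  rw [LinearIndependent.pair_iff] at h
  intro p q hpq
  have h0 : A (p - q) = 0 := by rw [map_sub, hpq, sub_self]
  have hdec : p - q = (p - q).1 • ((1 : ℝ), (0 : ℝ)) + (p - q).2 • ((0 : ℝ), (1 : ℝ)) := by
    ext <;> simp
  rw [hdec, map_add, map_smul, map_smul] at h0
  obtain ⟨ha, hb⟩ := h _ _ h0
  have : p - q = 0 := by
    rw [hdec, ha, hb, zero_smul, zero_smul, add_zero]
  exact sub_eq_zero.1 this

/-- The values of an injective linear map of `ℝ × ℝ` on `(1, 0)`, `(0, 1)` are linearly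
independent. [folklore] -/
theorem linearIndependent_pair_of_injective {F' : Type*} [AddCommGroup F'] [Module ℝ F']
    {A : ℝ × ℝ →ₗ[ℝ] F'} (h : Injective A) : LinearIndependent ℝ ![A (1, 0), A (0, 1)] := by
  rw [LinearIndependent.pair_iff]
  intro s t hst
  have h0 : A (s • ((1 : ℝ), (0 : ℝ)) + t • ((0 : ℝ), (1 : ℝ))) = A 0 := by
    rw [map_add, map_smul, map_smul, hst, map_zero]
  have h1 := h h0
  have h2 : (s • ((1 : ℝ), (0 : ℝ)) + t • ((0 : ℝ), (1 : ℝ))) = (s, t) := by ext <;> simp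
  rw [h2] at h1
  exact ⟨congrArg Prod.fst h1, congrArg Prod.snd h1⟩

/-- **Injectivity of the differential is an open condition** for a `C¹` map of two real
variables into a finite-dimensional space (linear independence of the two partial derivatives is
open, `isOpen_setOf_linearIndependent`, and the differential is continuous). [folklore] -/
theorem isOpen_setOf_injective_fderiv_two {F' : Type*} [NormedAddCommGroup F'] [NormedSpace ℝ F']
    [FiniteDimensional ℝ F'] {g : ℝ × ℝ → F'} (hg : ContDiff ℝ 1 g) :
    IsOpen {q : ℝ × ℝ | Injective (fderiv ℝ g q)} := by
  have hcont : Continuous fun q : ℝ × ℝ ↦ fderiv ℝ g q := hg.continuous_fderiv one_ne_zero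
  have hc2 : Continuous fun q : ℝ × ℝ ↦ (![fderiv ℝ g q (1, 0), fderiv ℝ g q (0, 1)] : Fin 2 → F') := by
    refine continuous_pi fun i ↦ ?_
    fin_cases i
    · exact (ContinuousLinearMap.apply ℝ F' ((1 : ℝ), (0 : ℝ))).continuous.comp hcont
    · exact (ContinuousLinearMap.apply ℝ F' ((0 : ℝ), (1 : ℝ))).continuous.comp hcont
  have heq : {q : ℝ × ℝ | Injective (fderiv ℝ g q)} =
      (fun q : ℝ × ℝ ↦ (![fderiv ℝ g q (1, 0), fderiv ℝ g q (0, 1)] : Fin 2 → F')) ⁻¹'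
        {f : Fin 2 → F' | LinearIndependent ℝ f} := by
    ext q
    simp only [mem_setOf_eq, mem_preimage]
    constructor
    · intro h
      exact linearIndependent_pair_of_injective (A := (fderiv ℝ g q : ℝ × ℝ →ₗ[ℝ] F')) h
    · intro h
      exact injective_of_linearIndependent_pair (A := (fderiv ℝ g q : ℝ × ℝ →ₗ[ℝ] F')) h
  rw [heq]
  exact isOpen_setOf_linearIndependent.preimage hc2

/-- **Uniform injectivity of the differential near a compact segment**: if a `C¹` map `g` of two
real variables has injective differential at the points `(x, 0)`, `x ∈ C`, `C` compact, then it
has injective differential at all `(x, y)` with `x ∈ C`, `|y| < ε`, for some `ε > 0`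
(openness and the generalized tube lemma). [folklore] -/
theorem exists_forall_injective_fderiv_near {F' : Type*} [NormedAddCommGroup F'] [NormedSpace ℝ F']
    [FiniteDimensional ℝ F'] {g : ℝ × ℝ → F'} (hg : ContDiff ℝ 1 g) {C : Set ℝ} (hC : IsCompact C)
    (h0 : ∀ x ∈ C, Injective (fderiv ℝ g (x, 0))) :
    ∃ ε > 0, ∀ x ∈ C, ∀ y : ℝ, |y| < ε → Injective (fderiv ℝ g (x, y)) := by
  have hopen := isOpen_setOf_injective_fderiv_two hg
  have hsub : C ×ˢ ({0} : Set ℝ) ⊆ {q : ℝ × ℝ | Injective (fderiv ℝ g q)} := by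
    rintro ⟨x, y⟩ ⟨hx, hy⟩
    rw [mem_singleton_iff] at hy
    subst hy
    exact h0 x hx
  obtain ⟨U, W, -, hWo, hU, hW, hUW⟩ := generalized_tube_lemma hC isCompact_singleton hopen hsub
  obtain ⟨ε, hε, hball⟩ := Metric.isOpen_iff.1 hWo 0 (hW (mem_singleton 0))
  refine ⟨ε, hε, fun x hx y hy ↦ ?_⟩
  have hyW : y ∈ W := hball (by simpa [Real.dist_eq] using hy)
  exact hUW (⟨hU hx, hyW⟩ : (x, y) ∈ U ×ˢ W)

end Literature.Topology.FourManifolds
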